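import Summits.NavierStokesRegularity.NavierStokesRegularity.Theses.AxisymmetricExtremality
import Summits.NavierStokesRegularity.NavierStokesRegularity.Theorems.AxisymmetricExtremalityAxisymmetricKatoGlobalStubSereginLogSwirlOriginStep3Absorb
import Summits.NavierStokesRegularity.NavierStokesRegularity.Theorems.AxisymmetricExtremalityAxisymmetricKatoGlobalStubSereginLogSwirlOriginStep3SourcePhi
import HarnessLib

/-!
# Seregin 2022, §2 Step 3: the key estimate `sup_t ∫η⁶(Γ² + Φ²) + ∫∫(η³|∇Γ|)² + (η³|∇Φ|)² ≤ C`
# for a classical axisymmetric solution on a slab, from (2.2), Lemma 2.2 and Lemma 2.1 (ii)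
# (numeric) — crux stmt-NavierStokesRegularity-15453 (`AxisymmetricExtremality.AxisymmetricKatoGlobal`), line registered, support for stub `stub_sereginLogSwirlOrigin`

Support file (`--supports stmt-NavierStokesRegularity-15453`; theorems only, everything proved)
toward the registered stub `stub_sereginLogSwirlOrigin` = the named fact
`Literature.Analysis.FluidPDE.seregin2022_logSwirl_regularAtOrigin` (G. Seregin, J. Math. Fluid
Mech. 24 (2022), Paper 27 = arXiv:2201.00153, §2). This file assembles Step 3 (arXiv pp. 6–7)
from its pieces in this namespace: the `η⁶`-weighted inequalities of `Γ = ω_θ/r` and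
`Φ = ω_r/r` (`…Step3Gamma`, `…Step3Integrated`), the `B₃` bound by (2.2) + Lemma 2.2
(`…Step3SwirlSource`), the `A₃` bound by the stream form + (2.2) + Lemma 2.2 + Lemma 2.1 (ii)
(`…Step3SourcePhi`), and the absorption (`…Step3Absorb`):

* `cutoff_energy_keyEstimate_of_lemma21` (registered sub-goal) — **the key estimate of Step 3**
  ("`sup_{-1<t<0}∫_𝒞η⁶(|Γ|² + |Φ|²)dx + ∫_Q(η³|∇Φ|)² + (η³|∇Γ|)²dxdt ≤ C(v,η,r₁)`", in the
  `η³G`-form `|η³Φ|²_{2,Q} + |η³Γ|²_{2,Q}` consumed by Step 4). Setting: classical axisymmetric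
  solution of the unforced Navier–Stokes system (viscosity `ν`) on the open slab `(T₀, T₁)` (the
  singularity-free slab of Step 1), cut-off `ζ = η³` jointly smooth, axisymmetric, supported in
  `𝒞 = spaceCyl 0 1`, `[t₁, t₂] ⊆ (T₀, T₁)`. Hypotheses for `t ∈ [t₁, t₂]`: (2.2) as
  `|σ| ≤ C₁/ln³(e/r)` on `0 < r < r₁ < 1`; the numeric constants of the paper's `C(v,η,r₁)`
  (boundedness of `v, ∇v, ∇²v, ∇ω` on `supp ∇η` and on `{r ≥ r₁}`): `M` for `|(v_θ/r)(ζΓ)(ζΦ)|`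
  on `r ≥ r₁`, `Bcut` for the eight cut-off terms `A₁ + A₂ + B₁ + B₂`, `P₀` for `|v_θ||∇(ζv_r/r)|`
  on `r ≥ r₁`, `P₁` for `|v_r/r||v_θ||∇ζ|`, `P₂` for `|ζΦ||v_θ||∇ζ||∇(v_r/r)|`; Lemma 2.1 (ii)
  in the numeric form `∫|∇²(ζv_r/r)|² ≤ c_L∫|∇(ζΓ)|² + C_L`; and the smallness
  `8C₁/ln(e/r₁) + C₁(1 + 4c_L)/ln²(e/r₁) + 4ε < 2ν` (the paper's
  `cC₁/ln(e/r₁) + cC₁²/ln⁴(e/|r₁|) < 2`; `exists_radius_logSmall`). Conclusion: with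
  `K = E(t₁) + (Bcut + B_A + 4M|B(0,2)|)(t₂ − t₁)`, `E = ∫(ζΓ)² + ∫(ζΦ)²`,
  `B_A = 4C₁C_L/ln²(e/r₁) + ((P₀² + P₁²)/(2ε) + 2P₂)|B(0,2)|`:
  `sup_{[t₁,t₂]} E ≤ K` and `∫_{t₁}^{t₂}(∫|∇(ζΓ)|² + ∫|∇(ζΦ)|²) ≤ K/(2ν − θ)` (stated with any
  upper bound `V ≥ |B(0,2)|` of the ball volume, to keep the registered signature short).

What then remains of the named fact: Lemma 2.1 (ii) in localised form (its global core is
`…CFZBounds`, the Hmidi–Rousset identity `…HmidiRousset`, the cut-off div–curl estimates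
`…CutoffDivCurl*`), the elementary derivation of `M, Bcut, P₀, P₁, P₂` from sup-norm bounds on
`supp ∇η ∪ {r ≥ r₁}`, Step 1 (cut-off adapted to partial regularity, `…TopTimePartialRegularity`,
`…ParabolicNullLines`, `…Step13Tools`) and Step 4 (`…VThetaPassage`, `…Step4Endgame`) for the
suitable weak solution.

## Mathlib / tree search

Tree: `cutoff_energy_keyEstimate` (`…Step3Absorb`), `two_mul_integral_sourcePhi_le`
(`…Step3SourcePhi`), `log_exp_div_eq` (`…Step3SwirlSource`). `lean search 'keyEstimate_of_lemma21'`: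
no matches (2026-08-17).

## References

* G. Seregin, J. Math. Fluid Mech. 24 (2022), Paper No. 27 = arXiv:2201.00153, §2 Step 3
  (arXiv pp. 6–7). [`Seregin2022LocalAxisym`]
-/

noncomputable section

open MeasureTheory Set Filter Topology Function Metric intervalIntegral
open scoped ENNReal ContDiff
open Literature.Analysis.FluidPDE

-- `<Problem> = <Summit>` duplicates a namespace component by design (lakefile sets the same option).
set_option linter.dupNamespace false

namespace Summit.NavierStokesRegularity.NavierStokesRegularity.Theorems.AxisymmetricKatoGlobal.EulerScaling

/-- **Seregin 2022, §2 Step 3, the key estimate** for a classical axisymmetric solution on a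
slab, with (2.2), Lemma 2.2 and the absorption supplied by the tree and Lemma 2.1 (ii) as a
numeric hypothesis (see the module docstring for the meaning of the constants).
[cite: Seregin2022LocalAxisym, §2 Step 3 (arXiv:2201.00153 p. 7, the key estimate)] -/
theorem cutoff_energy_keyEstimate_of_lemma21 : ∀ (a b ν : ℝ) (v : ℝ → EuclideanSpace ℝ (Fin 3) → EuclideanSpace ℝ (Fin 3)) (q : ℝ → EuclideanSpace ℝ (Fin 3) → ℝ) (ζ : ℝ → EuclideanSpace ℝ (Fin 3) → ℝ) (t₁ t₂ C₁ r₁ M Bcut ε P₀ P₁ P₂ cL CL V : ℝ), IsClassicalNSSolutionOn (Ioo a b) ν 0 v q → (∀ s ∈ Ioo a b, IsAxisymmetric (v s)) → 0 ≤ ν → IsSmoothSpaceTimeOn (Ioo a b) ζ → (∀ s ∈ Ioo a b, IsAxisymmetricScalar (ζ s)) → (∀ s ∈ Ioo a b, tsupport (ζ s) ⊆ SereginSverak2009.spaceCyl 0 1) → Icc t₁ t₂ ⊆ Ioo a b → t₁ ≤ t₂ → 0 ≤ C₁ → 0 < r₁ → r₁ < 1 → 0 ≤ M → 0 ≤ Bcut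 → 0 < ε → 0 ≤ P₂ → 0 ≤ cL → 0 ≤ CL → volume.real (closedBall (0 : EuclideanSpace ℝ (Fin 3)) 2) ≤ V → (∀ t ∈ Icc t₁ t₂, ∀ x, 0 < cylRadius x → cylRadius x < r₁ → |swirl (v t) x| ≤ C₁ / Real.log (Real.exp 1 / cylRadius x) ^ 3) → (∀ t ∈ Icc t₁ t₂, ∀ x, r₁ ≤ cylRadius x → |angVelQuot (v t) x * (ζ t x * angVortQuot (v t) x) * (ζ t x * radVelQuot (curl (v t)) x)| ≤ M) → (∀ t ∈ Icc t₁ t₂, (2 * (∫ x, ζ t x * timeDerivWithin (Ioo a b) ζ t x * angVortQuot (v t) x ^ 2) + 2 * (∫ x, ζ t x * angVortQuot (v t) x ^ 2 * fderiv ℝ (ζ t) x (v t x)) + 2 * ν * (∫ x, angVortQuot (v t) x ^ 2 * (fderiv ℝ (ζ t) x (EuclideanSpace.single 0 1) ^ 2 + fderiv ℝ (ζ t) x (EuclideanSpace.single 1 1) ^ 2 + fderiv ℝ (ζ t) x (EuclideanSpace.single 2 1) ^ 2)) - 4 * ν * (∫ x, ζ t x * angVortQuot (v t) x ^ 2 *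 radDerivQuot (ζ t) x)) + (2 * (∫ x, ζ t x * timeDerivWithin (Ioo a b) ζ t x * radVelQuot (curl (v t)) x ^ 2) + 2 * (∫ x, ζ t x * radVelQuot (curl (v t)) x ^ 2 * fderiv ℝ (ζ t) x (v t x)) + 2 * ν * (∫ x, radVelQuot (curl (v t)) x ^ 2 * (fderiv ℝ (ζ t) x (EuclideanSpace.single 0 1) ^ 2 + fderiv ℝ (ζ t) x (EuclideanSpace.single 1 1) ^ 2 + fderiv ℝ (ζ t) x (EuclideanSpace.single 2 1) ^ 2)) - 4 * ν * (∫ x, ζ t x * radVelQuot (curl (v t)) x ^ 2 * radDerivQuot (ζ t) x)) ≤ Bcut) → (∀ t ∈ Icc t₁ t₂, ∀ x, r₁ ≤ cylRadius x → |swirlVelocity (v t) x| * ‖fderiv ℝ (fun y => ζ t y * radVelQuot (v t) y) x‖ ≤ P₀) → (∀ t ∈ Icc t₁ t₂, ∀ x, |radVelQuot (v t) x| * |swirlVelocity (v t) x| * ‖fderiv ℝ (ζ t) x‖ ≤ P₁) → (∀ t ∈ Icc t₁ t₂, ∀ x, |ζ t x * radVelQuot (curl (v t)) x| * |swirlVelocity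 (v t) x| * (‖fderiv ℝ (ζ t) x‖ * ‖fderiv ℝ (radVelQuot (v t)) x‖) ≤ P₂) → (∀ t ∈ Icc t₁ t₂, (∫ x, ∑ i : Fin 3, ∑ j : Fin 3, (fderiv ℝ (fun y => fderiv ℝ (fun y => ζ t y * radVelQuot (v t) y) y (EuclideanSpace.single i 1)) x (EuclideanSpace.single j 1)) ^ 2) ≤ cL * (∫ x, (fderiv ℝ (fun y => ζ t y * angVortQuot (v t) y) x (EuclideanSpace.single 0 1) ^ 2 + fderiv ℝ (fun y => ζ t y * angVortQuot (v t) y) x (EuclideanSpace.single 1 1) ^ 2 + fderiv ℝ (fun y => ζ t y * angVortQuot (v t) y) x (EuclideanSpace.single 2 1) ^ 2)) + CL) → 8 * C₁ / Real.log (Real.exp 1 / r₁) + (C₁ * (1 + 4 * cL) / Real.log (Real.exp 1 / r₁) ^ 2 + 4 * ε) < 2 * ν → (∀ t ∈ Icc t₁ t₂, (∫ x, (ζ t x * angVortQuot (v t) x) ^ 2) + (∫ x, (ζ t x * radVelQuot (curl (v t)) x) ^ 2) ≤ (∫ x, (ζ t₁ x * angVortQuot (v t₁) x) ^ 2) + (∫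 x, (ζ t₁ x * radVelQuot (curl (v t₁)) x) ^ 2) + (Bcut + (4 * C₁ * CL / Real.log (Real.exp 1 / r₁) ^ 2 + ((P₀ ^ 2 + P₁ ^ 2) / (2 * ε) + 2 * P₂) * V) + 4 * M * V) * (t₂ - t₁)) ∧ ∫ s in t₁..t₂, ((∫ x, (fderiv ℝ (fun y => ζ s y * angVortQuot (v s) y) x (EuclideanSpace.single 0 1) ^ 2 + fderiv ℝ (fun y => ζ s y * angVortQuot (v s) y) x (EuclideanSpace.single 1 1) ^ 2 + fderiv ℝ (fun y => ζ s y * angVortQuot (v s) y) x (EuclideanSpace.single 2 1) ^ 2)) + (∫ x, (fderiv ℝ (fun y => ζ s y * radVelQuot (curl (v s)) y) x (EuclideanSpace.single 0 1) ^ 2 + fderiv ℝ (fun y => ζ s y * radVelQuot (curl (v s)) y) x (EuclideanSpace.single 1 1) ^ 2 + fderiv ℝ (fun y => ζ s y * radVelQuot (curl (v s)) y) x (EuclideanSpace.single 2 1) ^ 2))) ≤ ((∫ x, (ζ t₁ x * angVortQuot (v t₁) x) ^ 2) + (∫ x, (ζ t₁ x * radVelQuot (curl (v t₁)) x) ^ 2)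 + (Bcut + (4 * C₁ * CL / Real.log (Real.exp 1 / r₁) ^ 2 + ((P₀ ^ 2 + P₁ ^ 2) / (2 * ε) + 2 * P₂) * V) + 4 * M * V) * (t₂ - t₁)) / (2 * ν - 8 * C₁ / Real.log (Real.exp 1 / r₁) - (C₁ * (1 + 4 * cL) / Real.log (Real.exp 1 / r₁) ^ 2 + 4 * ε)) := by
  intro a b ν v q ζ t₁ t₂ C₁ r₁ M Bcut ε P₀ P₁ P₂ cL CL V hns hax hν hζ hζax hζs hsub h12 hC₁ hr₁ hr₁1 hM hBcut hε hP₂ hcL hCL hV hσ hfar hcut hP0 hP1 hP2 hL21 hsmall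
  have hVOL : 0 ≤ volume.real (closedBall (0 : EuclideanSpace ℝ (Fin 3)) 2) := measureReal_nonneg
  have hL₁0 : 0 < Real.log (Real.exp 1 / r₁) := by
    rw [log_exp_div_eq r₁ hr₁]; linarith [Real.log_neg hr₁ hr₁1]
  have hBA : 0 ≤ (4 * C₁ * CL / Real.log (Real.exp 1 / r₁) ^ 2 + ((P₀ ^ 2 + P₁ ^ 2) / (2 * ε) + 2 * P₂) * volume.real (closedBall (0 : EuclideanSpace ℝ (Fin 3)) 2)) := by positivity
  have hA3 : ∀ t ∈ Icc t₁ t₂, 2 * (∫ x, ζ t x ^ 2 * radVelQuot (curl (v t)) x * fderiv ℝ (radVelQuot (v t)) x (curl (v t) x)) ≤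
      (C₁ * (1 + 4 * cL) / Real.log (Real.exp 1 / r₁) ^ 2 + 4 * ε) * ((∫ x, (fderiv ℝ (fun y => ζ t y * angVortQuot (v t) y) x (EuclideanSpace.single 0 1) ^ 2 + fderiv ℝ (fun y => ζ t y * angVortQuot (v t) y) x (EuclideanSpace.single 1 1) ^ 2 + fderiv ℝ (fun y => ζ t y * angVortQuot (v t) y) x (EuclideanSpace.single 2 1) ^ 2)) + (∫ x, (fderiv ℝ (fun y => ζ t y * radVelQuot (curl (v t)) y) x (EuclideanSpace.single 0 1) ^ 2 + fderiv ℝ (fun y => ζ t y * radVelQuot (curl (v t)) y) x (EuclideanSpace.single 1 1) ^ 2 + fderiv ℝ (fun y => ζ t y * radVelQuot (curl (v t)) y) x (EuclideanSpace.single 2 1) ^ 2))) + (4 * C₁ * CL / Real.log (Real.exp 1 / r₁) ^ 2 + ((P₀ ^ 2 + P₁ ^ 2) / (2 * ε) + 2 * P₂) * volume.real (closedBall (0 : EuclideanSpace ℝ (Fin 3)) 2)) := by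
    intro t ht
    have hts : t ∈ Ioo a b := hsub ht
    have hv4 : ContDiff ℝ 4 (v t) := (hns.contDiff_velocity hts).of_le (by norm_cast)
    have hζ2 : ContDiff ℝ 2 (ζ t) := (hζ.contDiff_slice hts).of_le (by norm_cast)
    exact two_mul_integral_sourcePhi_le (v t) (ζ t) C₁ r₁ ε P₀ P₁ P₂ cL CL (hax t hts) hv4 hζ2 (hζax t hts)
      (hζs t hts) hC₁ hr₁ hr₁1 hε hP₂ hcL (hσ t ht) (hP0 t ht) (hP1 t ht) (hP2 t ht) (hL21 t ht)
  obtain ⟨hsup, hdiss⟩ := cutoff_energy_keyEstimate a b ν v q ζ t₁ t₂ C₁ r₁ M (C₁ * (1 + 4 * cL) / Real.log (Real.exp 1 / r₁) ^ 2 + 4 * ε) (4 * C₁ * CL / Real.log (Real.exp 1 / r₁) ^ 2 + ((P₀ ^ 2 + P₁ ^ 2) / (2 * ε) + 2 * P₂) * volume.real (closedBall (0 : EuclideanSpace ℝ (Fin 3)) 2)) Bcut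
    hns hax hν hζ hζax hζs hsub hC₁ hr₁ hr₁1 hM hσ hfar hcut hA3 hBcut hBA hsmall h12
  -- replace the ball volume by its upper bound `V`
  have hcoef : 0 ≤ (P₀ ^ 2 + P₁ ^ 2) / (2 * ε) + 2 * P₂ := by positivity
  have hmono : (Bcut + (4 * C₁ * CL / Real.log (Real.exp 1 / r₁) ^ 2 + ((P₀ ^ 2 + P₁ ^ 2) / (2 * ε) + 2 * P₂) * volume.real (closedBall (0 : EuclideanSpace ℝ (Fin 3)) 2)) + 4 * M * volume.real (closedBall (0 : EuclideanSpace ℝ (Fin 3)) 2)) * (t₂ - t₁) ≤ (Bcut + (4 * C₁ * CL / Real.log (Real.exp 1 / r₁) ^ 2 + ((P₀ ^ 2 + P₁ ^ 2) / (2 * ε) + 2 * P₂) * V) + 4 * M * V) * (t₂ - t₁) := by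
    apply mul_le_mul_of_nonneg_right _ (by linarith)
    nlinarith [mul_le_mul_of_nonneg_left hV hcoef, mul_le_mul_of_nonneg_left hV hM]
  have hpos : 0 < 2 * ν - 8 * C₁ / Real.log (Real.exp 1 / r₁) - (C₁ * (1 + 4 * cL) / Real.log (Real.exp 1 / r₁) ^ 2 + 4 * ε) := by linarith
  refine ⟨fun t ht => (hsup t ht).trans (by linarith), hdiss.trans ?_⟩
  exact div_le_div_of_nonneg_right (by linarith) hpos.le

end Summit.NavierStokesRegularity.NavierStokesRegularity.Theorems.AxisymmetricKatoGlobal.EulerScaling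

end
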